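import Literature.MathematicalPhysics.QuantumFieldTheory.Balaban1983to89.B7Eq84Concrete
import Literature.MathematicalPhysics.QuantumFieldTheory.Balaban1983to89.B9Eq3114Proof
import HarnessLib

/-!
# `UnitScaleTiltProp7CombFramesFlatPureGauge` — THE COMB FRAMES (85) OF A FLAT PURE GAUGE ARE THE AVERAGED GAUGE TRANSFORMATION: on `ℤᵈ`, for every invertible site
# function `v`, `w_k(1, 1ᵛ)(z) = v(Lᵏz)·(R̄₀(v⁻¹))ᵏ(z)` EXACTLY, the double-bar average of `1ᵛ` is the coarse pure gauge of `((R̄₀(v⁻¹))ᵏ)⁻¹`, and along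
# `v_t = e^{tλ}` the frame has derivative `λ(Lᵏz) − (Q′_kλ)(z)`, `Q′_k` the iterated plain block mean
(route `UnitScaleTilt`, crux K1 «MinimiserStabilityRegPr» stmt-QuantumFields-19200; ★★OWNER ym3-torus-plan g29 RULING №17 (2) «COMB-FLAT COERCIVITY», pen px6 g5; item (I1a) of the
LOCATE memo `LOCATE-COMBFLAT-px6g5.md` (19200 evidence #60) — the `ℤᵈ` half of row (hR) of ✓`Prop7LaplaceAcFlatTransfer.coercive_laplaceAc_one_of_sliceBound`; def-free, count-neutral).
Cell `ym3-torus` (HUMAN RULING D-0037, YM ladder rung R3 — YM₃ on T³ is a rung, not d = 4, not a mass gap, not Clay), width seat `ym3-torus-px6` (gen 5).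

THE PRINT.  [Balaban1985Averaging] p.30–31: (78)–(81) the averaging `R̄₀uʲ` of gauge transformations, (84) «(\overline{R₀u}ʲ)(x_j) = u(x_j)\overline{R_{0,x_j}U₁}^{(j)}»,
(85) the block frames `w_j`, (87)–(88), (92) `Ũ₁ᵏ = (U̿₁ᵏ)^{w_k}`.  [Balaban1985BackgroundPropagators] p.418: «we calculate it for U′^u with U′ = 1 … R_yU′‾ = u(y)(R̄u)⁻¹(y), hence
Ū′_c = (R̄u)(c₋)R̄_c(R̄u)⁻¹(c₊). Taking logarithms of both sides, and linear parts in λ, we obtain (QD^{L⁻¹}λ)(c) = (D_ŪQ′λ)(c). (3.114) Iterating this identity we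
obtain finally Q_jDλ = D̄ʲQ′_jλ (3.115)»; p.394 «operators Q′_j(U) are linear parts of the averaging operations R̄uʲ».
WHAT IS PROVED (sorry-free, no definition, no hypothesis beyond `1 ≤ L` in §3; `𝔸` any complete normed `ℂ`-algebra, `1ᵛ := gaugeAct v 1`):
* §1 `axialGauge_one_gaugeAct_inv` — `v⁻¹` carries `1ᵛ` to the (trivially) axial configuration `1`: `AxialGauge L 1 (1ᵛ) v⁻¹ k`.
* §2 ★★★ **`wrec_one_gaugeAct`** — `wrec L 1 (1ᵛ) k z = v(Lᵏ•z) · uavg L 1 v⁻¹ k z` (lit ✓`B7Eq84Concrete.eq84_top` at the pair (`1ᵛ`, `v⁻¹`)); hence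
  ★ **`dbavgCovIter_one_gaugeAct`** — `U̿(1ᵛ)ᵏ = gaugeAct (uavg L 1 v⁻¹ k)⁻¹ 1` (lit ✓`B7Eq99Concrete.tildIter_eq_mgauge_wrec` + ✓`B7Prop6Flat.avgIter_gaugeAct_units`): print's
  «Ū′ = (R̄u)(c₋)R̄_c(R̄u)⁻¹(c₊)» ITERATED to level `k` at the flat background, with NO domain condition.
* §3 `uavg_one_one` (`R̄₀1ʲ = 1`; `e^0 = 1` is lit ✓`B7Prop8Flat.expUnit_zero`, inlined); ★ **`hasDerivAt_uavg_one_exp`** — `d/dt|₀ (uavg L 1 (e^{tλ}) k z) = (Q′_kλ)(z)`, `Q′_k = B9Eq3114Proof.P12.QpIter L 1 λ k` (the iterated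
  block mean; lit ✓`B7Eq78Linearization.hasDerivAt_avgStep_of_sum_eq_one` through ✓`B9Eq3114Proof.val_R0avg_eq_avgStep`); ★★★ **`hasDerivAt_wrec_one_exp`** —
  `d/dt|₀ w_k(1, 1^{e^{tλ}})(z) = λ(Lᵏ•z) + (Q′_k(−λ))(z)`: THE LINEARISED COMB FRAME ON A FLAT PURE GAUGE IS «VALUE AT THE BASE POINT MINUS BLOCK MEAN».
WHY (LOCATE memo §2, identity (I1)): with ✓`Prop7SymAvgTwBridge.QTw_eq_QSym_sub` (`QTw 1 = QSym 1 − D̄∘r(1)`, `r(1)` = the derivative of `frameTw 1 = wrec L 1 (·)♯ (K−n) ∘ coordT3`)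
and ✓`Prop7QSymGaugeCovariance.QSym_gaugeDir` (`QSym 1 (D(1)λ) = D̄(λ∘x̂)`), §3 gives `QTw 1 (D(1)λ) = D̄(Q′_{K−n}λ♯)` — print's (3.115) at the flat member for the route's
twisted average — whence `N_c(1) = N_S(1)` and `Rc 1 = RS 1` (row (hR)); the torus assembly (pullbacks `pull_gaugeActT`, `embIter_eq_transl`) is item (I1b), not this file.
HONEST FRAMING.  `ℤᵈ` identities about lit objects only; nothing of (hR) on the torus, of COMB-FLAT COERCIVITY, of HESS ∕ E′ ∕ EX ∕ the crux K1 is proved here; rung R3, not Clay;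
YM gap NOT proved.  `--supports stmt-QuantumFields-19200 --as helper`.
References: T. Bałaban, CMP 98 (1985) 17–51 [Balaban1985Averaging] ((78)–(88) pp.30–31, (92) p.31); CMP 99 (1985) 389–434 [Balaban1985BackgroundPropagators] ((3.19) p.393,
p.394, (3.113)–(3.115) p.418).
-/

noncomputable section

open scoped Topology
open NormedSpace (exp)

namespace Summit.QuantumFields.YangMills.Theorems.Prop7CombFramesFlatPureGauge

open Literature.MathematicalPhysics.QuantumFieldTheory.Balaban1983to89
open B7Prop1Explicit B7Prop2Explicit B7Eq92Concrete B7Eq99Concrete B7Eq84Concrete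
open B7AvgGaugeCovariance (uLev uLev_apply)
open B7Prop6Flat (avgIter_gaugeAct_units)
open B7Eq78Linearization (avgStep Qprime hasDerivAt_avgStep_of_sum_eq_one hasDerivAt_exp_smul_zero)
open B9Eq3114Proof (val_R0avg_eq_avgStep)
open B9Eq3114Proof.P12 (QpIter QpIter_zero QpIter_succ Qp_eq_Qprime)

variable {d : ℕ}
variable {𝔸 : Type*} [NormedRing 𝔸] [NormedAlgebra ℂ 𝔸] [CompleteSpace 𝔸]
variable (L : ℕ)

/-! ## §1 The inverse gauge function carries a flat pure gauge to the axial configuration `1` -/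

omit [NormedAlgebra ℂ 𝔸] [CompleteSpace 𝔸] in
/-- `(1ᵛ)^{v⁻¹} = 1` bondwise (moving frame at the flat background = ordinary gauge action). [cite: Balaban1985Averaging, (55) p.27, (8) p.18] -/
theorem mgauge_one_inv_gaugeAct (v : Site d → 𝔸ˣ) :
    mgauge (1 : Site d → Fin d → 𝔸ˣ) v⁻¹ (gaugeAct v 1) = 1 := by
  funext x κ
  simp only [mgauge_one_left, gaugeAct, Pi.inv_apply, Pi.one_apply, mul_one, inv_inv, inv_mul_cancel_left, inv_mul_cancel]

/-- **`v⁻¹` IS AN AXIAL GAUGE FIXING OF `1ᵛ` AT THE FLAT BACKGROUND** ((67) at every level: all twisted holonomies of `Ũ(1)ʲ = 1` are `1`). [cite: Balaban1985Averaging, (67) p.29] -/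
theorem axialGauge_one_gaugeAct_inv (v : Site d → 𝔸ˣ) (k : ℕ) :
    AxialGauge L (1 : Site d → Fin d → 𝔸ˣ) (gaugeAct v 1) v⁻¹ k := by
  intro j _ z r
  rw [mgauge_one_inv_gaugeAct, avgIter_one]
  have h1 : tildIter L (1 : Site d → Fin d → 𝔸ˣ) 1 j = 1 := by
    funext z' κ
    rw [tildIter_apply, one_mul, avgIter_one, Pi.one_apply, Pi.one_apply, mul_inv_cancel]
  rw [h1, tHol_one_left, B8Ineq130.hol_one]

/-! ## §2 (84) at the pair (`1ᵛ`, `v⁻¹`): the frames and the double-bar average of a flat pure gauge, exactly -/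

/-- ★★★ **THE COMB FRAMES OF A FLAT PURE GAUGE**: `w_k(1, 1ᵛ)(z) = v(Lᵏ•z) · (R̄₀(v⁻¹))ᵏ(z)` — [Balaban1985Averaging] (84) «(\overline{R₀u}ᵏ)(x_k) = u(x_k)\overline{R_{0,x_k}U₁}^{(k)}» at
`U₀ = 1`, `U₁ = 1ᵛ`, `u = v⁻¹` (axial by §1), solved for the frame; no smallness, no domain condition. [cite: Balaban1985Averaging, (84) p.30, (85) p.31, (87) p.31] -/
theorem wrec_one_gaugeAct (v : Site d → 𝔸ˣ) (k : ℕ) (z : Site d) :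
    wrec L (1 : Site d → Fin d → 𝔸ˣ) (gaugeAct v 1) k z = v (((L : ℤ) ^ k) • z) * uavg L 1 v⁻¹ k z := by
  have h := eq84_top L (1 : Site d → Fin d → 𝔸ˣ) (gaugeAct v 1) v⁻¹ (axialGauge_one_gaugeAct_inv L v k) z
  rw [uLev_apply, Pi.inv_apply] at h
  rw [h, mul_inv_cancel_left]

omit [NormedAlgebra ℂ 𝔸] [CompleteSpace 𝔸] in
/-- composition of gauge actions: `(Vᵇ)ᵃ = V^{ab}`. [cite: Balaban1985Averaging, (8) p.18] -/
theorem gaugeAct_gaugeAct (a b : Site d → 𝔸ˣ) (V : Site d → Fin d → 𝔸ˣ) :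
    gaugeAct a (gaugeAct b V) = gaugeAct (a * b) V := by
  funext x κ
  simp only [gaugeAct, Pi.mul_apply, mul_inv_rev, mul_assoc]

/-- ★ **THE DOUBLE-BAR AVERAGE (90)–(92) OF A FLAT PURE GAUGE IS THE COARSE PURE GAUGE OF THE INVERSE AVERAGED INVERSE**: `U̿(1ᵛ)ᵏ = 1^{((R̄₀(v⁻¹))ᵏ)⁻¹}` — print's
«Ū′_c = (R̄u)(c₋)R̄_c(R̄u)⁻¹(c₊)» ([Balaban1985BackgroundPropagators] p.418, `u = v⁻¹`, `R̄_c = 1`) iterated to level `k`, from (92) `Ũ₁ᵏ = (U̿₁ᵏ)^{w_k}`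
(✓`tildIter_eq_mgauge_wrec`), (11)∕(43) `\overline{1ᵛ}ᵏ = 1^{v_k}` (✓`avgIter_gaugeAct_units`) and `wrec_one_gaugeAct`. [cite: Balaban1985Averaging, (92) p.31, (88) p.31;
Balaban1985BackgroundPropagators, (3.113) p.418] -/
theorem dbavgCovIter_one_gaugeAct (v : Site d → 𝔸ˣ) (k : ℕ) :
    dbavgCovIter L (1 : Site d → Fin d → 𝔸ˣ) (gaugeAct v 1) k = gaugeAct (uavg L 1 v⁻¹ k)⁻¹ 1 := by
  have h := tildIter_eq_mgauge_wrec L (1 : Site d → Fin d → 𝔸ˣ) (gaugeAct v 1) k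
  -- the left side: `Ũ(1ᵛ)ᵏ = \overline{1ᵛ}ᵏ = 1^{v_k}`
  have hl : tildIter L (1 : Site d → Fin d → 𝔸ˣ) (gaugeAct v 1) k = gaugeAct (uLev L v k) 1 := by
    funext z κ
    rw [tildIter_apply, mul_one, avgIter_one, Pi.one_apply, Pi.one_apply, inv_one, mul_one, avgIter_gaugeAct_units, avgIter_one]
  -- the frame: `w_k = v_k · ū`, so `w_k⁻¹ · v_k = ū⁻¹`
  have hw : wrec L (1 : Site d → Fin d → 𝔸ˣ) (gaugeAct v 1) k = uLev L v k * uavg L 1 v⁻¹ k := by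
    funext z
    rw [wrec_one_gaugeAct, Pi.mul_apply, uLev_apply]
  rw [avgIter_one, mgauge_one_left, hl, hw] at h
  -- `gaugeAct (v_k ū) U̿ = gaugeAct v_k 1` ⇒ `U̿ = gaugeAct ((v_k ū)⁻¹ v_k) 1 = gaugeAct ū⁻¹ 1`
  have h' := congrArg (gaugeAct (uLev L v k * uavg L 1 v⁻¹ k)⁻¹) h
  rw [gaugeAct_gaugeAct, gaugeAct_gaugeAct, inv_mul_cancel, mul_inv_rev, mul_assoc, inv_mul_cancel, mul_one] at h'
  have h1 : gaugeAct (1 : Site d → 𝔸ˣ) (dbavgCovIter L (1 : Site d → Fin d → 𝔸ˣ) (gaugeAct v 1) k)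
      = dbavgCovIter L (1 : Site d → Fin d → 𝔸ˣ) (gaugeAct v 1) k := by
    funext x κ
    simp only [gaugeAct, Pi.one_apply, one_mul, inv_one, mul_one]
  rw [h1] at h'
  exact h'.symm

/-! ## §3 Linear parts along `v_t = e^{tλ}`: `R̄₀` ↦ `Q′_k`, the frame ↦ «base value minus block mean» -/

/-- `R̄₀1ʲ = 1` at the flat background (indeed at any background: the average (78) of the trivial gauge function is trivial). [cite: Balaban1985Averaging, (78)–(81) p.30] -/
theorem uavg_one_one (U₀ : Site d → Fin d → 𝔸ˣ) : ∀ j : ℕ, uavg L U₀ (1 : Site d → 𝔸ˣ) j = 1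
  | 0 => rfl
  | j + 1 => by
    funext z
    rw [uavg_succ, uavg_one_one U₀ j, B9Eq3114Proof.R0avg_one_right, Pi.one_apply]

/-- ★ **«THE OPERATORS `Q′_j` ARE LINEAR PARTS OF THE AVERAGING OPERATIONS `R̄uʲ`» AT THE FLAT BACKGROUND, `k` LEVELS**: `d/dt|₀ (R̄₀(e^{tλ}))ᵏ(z) = (Q′_kλ)(z)` with
`Q′_k = QpIter L 1 λ k` (iterated block means; the transporters `1(Γ_{y,x}) = 1`).  Induction on `k` by lit ✓`hasDerivAt_avgStep_of_sum_eq_one` (normalised weights `Σ L⁻ᵈ = 1`,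
`1 ≤ L`) through ✓`val_R0avg_eq_avgStep`. [cite: Balaban1985BackgroundPropagators, (3.19) p.393, p.394; Balaban1985Averaging, (78)–(80) p.30] -/
theorem hasDerivAt_uavg_one_exp (hL : 1 ≤ L) (lam : Site d → 𝔸) :
    ∀ (k : ℕ) (z : Site d), HasDerivAt (fun t : ℂ => ((uavg L (1 : Site d → Fin d → 𝔸ˣ) (fun x => expUnit (t • lam x)) k z : 𝔸ˣ) : 𝔸))
      (QpIter L (1 : Site d → Fin d → 𝔸ˣ) lam k z) 0
  | 0, z => by
    simp only [uavg_zero, val_expUnit, QpIter_zero]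
    exact hasDerivAt_exp_smul_zero (lam z)
  | k + 1, z => by
    have h0 : ∀ x : Site d, ((uavg L (1 : Site d → Fin d → 𝔸ˣ) (fun x => expUnit ((0 : ℂ) • lam x)) k x : 𝔸ˣ) : 𝔸) = 1 := by
      intro x
      have : (fun x => expUnit ((0 : ℂ) • lam x)) = (1 : Site d → 𝔸ˣ) := funext fun x => Units.ext (by simp)
      rw [this, uavg_one_one, Pi.one_apply, Units.val_one]
    have h := hasDerivAt_avgStep_of_sum_eq_one (Finset.univ : Finset (Fin d → Fin L)) (fun _ => ((L : ℝ) ^ d)⁻¹)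
      (fun r => hol (avgIter L (1 : Site d → Fin d → 𝔸ˣ) k) (((L : ℤ)) • z) (treeWord (boxVec L r))) (sum_weights L hL)
      (γ := fun t : ℂ => ((uavg L (1 : Site d → Fin d → 𝔸ˣ) (fun x => expUnit (t • lam x)) k (((L : ℤ)) • z) : 𝔸ˣ) : 𝔸))
      (v := fun r (t : ℂ) => ((uavg L (1 : Site d → Fin d → 𝔸ˣ) (fun x => expUnit (t • lam x)) k (((L : ℤ)) • z + boxVec L r) : 𝔸ˣ) : 𝔸))
      (s₀ := 0) (h0 _) (fun r _ => h0 _)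
      (hasDerivAt_uavg_one_exp hL lam k _) (fun r _ => hasDerivAt_uavg_one_exp hL lam k _)
    simp only [uavg_succ, val_R0avg_eq_avgStep, QpIter_succ, Qp_eq_Qprime]
    exact h

/-- ★★★ **THE LINEARISED COMB FRAME ON A FLAT PURE GAUGE IS «BASE VALUE MINUS BLOCK MEAN»**: along `v_t = e^{tλ}`,
`d/dt|₀ w_k(1, 1^{v_t})(z) = λ(Lᵏ•z) + (Q′_k(−λ))(z)` (`= λ(x̂) − (Q′_kλ)(z)`; §2's exact formula, the product rule, §3 at `−λ`, `(e^{tλ})⁻¹ = e^{−tλ}`).  With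
✓`QTw_eq_QSym_sub` and ✓`QSym_gaugeDir` this is `QTw 1 (D(1)λ) = D̄(Q′_{K−n}λ♯)` — print's (3.115) at the flat member for the route's twisted average (torus assembly: item (I1b)).
[cite: Balaban1985BackgroundPropagators, (3.113)–(3.115) p.418; Balaban1985Averaging, (84)–(87) pp.30–31] -/
theorem hasDerivAt_wrec_one_exp (hL : 1 ≤ L) (lam : Site d → 𝔸) (k : ℕ) (z : Site d) :
    HasDerivAt (fun t : ℂ => ((wrec L (1 : Site d → Fin d → 𝔸ˣ) (gaugeAct (fun x => expUnit (t • lam x)) 1) k z : 𝔸ˣ) : 𝔸))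
      (lam (((L : ℤ) ^ k) • z) + QpIter L (1 : Site d → Fin d → 𝔸ˣ) (fun x => -lam x) k z) 0 := by
  have hinv : ∀ t : ℂ, (fun x => expUnit (t • lam x))⁻¹ = fun x => expUnit (t • (-lam x)) := by
    intro t; funext x; rw [Pi.inv_apply, val_inv_expUnit, smul_neg]
  have hfun : (fun t : ℂ => ((wrec L (1 : Site d → Fin d → 𝔸ˣ) (gaugeAct (fun x => expUnit (t • lam x)) 1) k z : 𝔸ˣ) : 𝔸))
      = fun t : ℂ => exp (t • lam (((L : ℤ) ^ k) • z))
          * ((uavg L (1 : Site d → Fin d → 𝔸ˣ) (fun x => expUnit (t • (-lam x))) k z : 𝔸ˣ) : 𝔸) := by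
    funext t
    rw [wrec_one_gaugeAct, hinv, Units.val_mul, val_expUnit]
  rw [hfun]
  have h1 := hasDerivAt_exp_smul_zero (lam (((L : ℤ) ^ k) • z))
  have h2 := hasDerivAt_uavg_one_exp L hL (fun x => -lam x) k z
  have h20 : ((uavg L (1 : Site d → Fin d → 𝔸ˣ) (fun x => expUnit ((0 : ℂ) • (-lam x))) k z : 𝔸ˣ) : 𝔸) = 1 := by
    have : (fun x => expUnit ((0 : ℂ) • (-lam x))) = (1 : Site d → 𝔸ˣ) := funext fun x => Units.ext (by simp)
    rw [this, uavg_one_one, Pi.one_apply, Units.val_one]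
  refine (h1.mul h2).congr_deriv ?_
  rw [h20, mul_one, zero_smul, NormedSpace.exp_zero, one_mul]

end Summit.QuantumFields.YangMills.Theorems.Prop7CombFramesFlatPureGauge

end
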